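import Mathlib.Data.Nat.Log
import Literature.Computability.Complexity.ACRealize
import Literature.Computability.Complexity.ConstantDepth
import HarnessLib

/-!
# Building bounded fan-in circuits of prescribed depth and size (trunk `CplxCore`)

The bounded fan-in companion of `ACRealize.lean`: a compositional toolkit for constructing
`B₂`-circuits (all gates of fan-in `≤ 2`, the basis of `NC k`, `ConstantDepth.lean`) with
simultaneous control of **depth** (every gate weighs `1`, `Circuit.depth`; hence also of
`Circuit.acDepth ≤ Circuit.depth`) and **size**, for multi-output maps
`F : (ι → Bool) → (κ → Bool)` (bit vectors, as needed to carry encoded field elements):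

* `NCVec F d s` — some well-formed gate list over `B2` with at most `s` gates has output wires,
  one for each `k : κ`, all of depth at most `d`, carrying `F x k`;
* closure: projections of inputs (`ncVec_proj`, depth `0`, size `0`), one gate of fan-in `≤ 2`
  on two earlier outputs (`NCVec.gate₂`, `NCVec.gate₁`), juxtaposition (`NCVec.pair`, depth `max`,
  sizes add; `NCVec.pi` over `Fin M`), **sequential composition** (`NCVec.comp`: depths add, sizes
  add — the depth companion `GateList.wdepths_append_reloc` of `GateList.vals_append_reloc`),
  and a **balanced binary tree** of a two-argument gadget over `M ≥ 1` blocks (`NCVec.tree`: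
  depth `+ ⌈log₂ M⌉ · d_op`, size `+ (M − 1) · s_op`; Vollmer 1999, Thm. 1.20-type constructions);
* `NCVec.toCircuit` — extraction of a `Circuit ι` over `B2` with `acDepth ≤ d`, `size ≤ s` for a
  single output, the form consumed by `DepthSizeClass`/`NC`.

## References

* H. Vollmer, *Introduction to Circuit Complexity* (1999), §1.2 (composition), §1.3.
* S. Arora, B. Barak, *Computational Complexity: A Modern Approach* (2009), Def. 6.23 (`NC`).
-/

namespace Literature.Computability.Complexity

open Finset GateList

variable {ι ι' : Type*} {κ κ' μ : Type*}

namespace GateList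

/-! ### Depths of a relocated block with rewired inputs -/

/-- The depth of a wire of a block whose inputs `i'` sit at depths `β i'`. [cite: Vollmer1999, §1.2] -/
def wireDepthFrom (β : ι' → ℕ) (ds : List ℕ) : ι' ⊕ ℕ → ℕ
  | .inl i => β i
  | .inr m => ds.getD m 0

/-- The depths of the gates of a block whose inputs `i'` sit at depths `β i'` (the fold of
`wdepths` started from the base depths `β` instead of `0`). [cite: Vollmer1999, §1.2] -/
def wdepthsFrom (w : GateFn → ℕ) (β : ι' → ℕ) (gs : List (Gate ι')) : List ℕ :=
  gs.foldl (fun ds g => ds ++ [w g.fn + univ.sup fun a => wireDepthFrom β ds (g.args a)]) []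

/-- One more gate appends its depth. [folklore] -/
theorem wdepthsFrom_append_singleton (w : GateFn → ℕ) (β : ι' → ℕ) (gs : List (Gate ι')) (g : Gate ι') :
    wdepthsFrom w β (gs ++ [g]) =
      wdepthsFrom w β gs ++ [w g.fn + univ.sup fun a => wireDepthFrom β (wdepthsFrom w β gs) (g.args a)] := by
  simp [wdepthsFrom, List.foldl_append]

/-- As many depths as gates. [folklore] -/
@[simp] theorem length_wdepthsFrom (w : GateFn → ℕ) (β : ι' → ℕ) (gs : List (Gate ι')) :
    (wdepthsFrom w β gs).length = gs.length := by
  induction gs using List.reverseRecOn with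
  | nil => rfl
  | append_singleton gs g ih => simp [wdepthsFrom_append_singleton, ih]

/-- With base depths `0` these are the ordinary depths. [folklore] -/
theorem wdepthsFrom_zero (w : GateFn → ℕ) (gs : List (Gate ι')) :
    wdepthsFrom w (fun _ => 0) gs = wdepths w gs := by
  induction gs using List.reverseRecOn with
  | nil => rfl
  | append_singleton gs g ih =>
    rw [wdepthsFrom_append_singleton, wdepths_append_singleton, ih]
    congr 3

/-- The depth of a shifted wire: it reads the second block's depths on the base depths given by
the wires `ρ` into the first block. [folklore] -/
theorem wireDepthOf_shiftWire (ds ws : List ℕ) {L : ℕ} (hL : ds.length = L) (ρ : ι' → ι ⊕ ℕ)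
    (hρ : WiresOK L ρ) (u : ι' ⊕ ℕ) :
    wireDepthOf (ds ++ ws) (shiftWire ρ L u) = wireDepthFrom (fun i => wireDepthOf ds (ρ i)) ws u := by
  cases u with
  | inl i =>
    simp only [shiftWire, wireDepthFrom]
    exact wireDepthOf_append_of_lt ds ws (ρ i) fun m hm => hL ▸ hρ i m hm
  | inr m =>
    simp only [shiftWire, wireDepthOf_inr, wireDepthFrom, List.getD_eq_getElem?_getD]
    rw [List.getElem?_append_right (by omega)]
    congr 2
    omega

/-- **Depths under relocation.** Appending to `gs` the block `gs'` relocated behind `gs` with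
input wires `ρ` gives first the depths of `gs`, then the depths of `gs'` computed from the base
depths of the wires `ρ` (the depth companion of `vals_append_reloc`). [cite: Vollmer1999, §1.2] -/
theorem wdepths_append_reloc (w : GateFn → ℕ) (gs : List (Gate ι)) (gs' : List (Gate ι'))
    (ρ : ι' → ι ⊕ ℕ) (hρ : WiresOK gs.length ρ) :
    wdepths w (gs ++ gs'.map (reloc ρ gs.length)) =
      wdepths w gs ++ wdepthsFrom w (fun i => wireDepthOf (wdepths w gs) (ρ i)) gs' := by
  induction gs' using List.reverseRecOn with
  | nil => simp [wdepthsFrom]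
  | append_singleton gs' g ih =>
    rw [List.map_append, List.map_singleton, ← List.append_assoc, wdepths_append_singleton, ih,
      wdepthsFrom_append_singleton, List.append_assoc]
    congr 2
    simp only [reloc_fn, List.cons.injEq, and_true]
    congr 1
    refine Finset.sup_congr rfl fun a _ => ?_
    exact wireDepthOf_shiftWire _ _ (length_wdepths w gs) ρ hρ (g.args a)

/-- **Base depths shift all depths by at most their bound**: if every base depth is `≤ D`, every
gate of the block has depth at most `D` plus its ordinary depth. [cite: Vollmer1999, §1.2] -/
theorem getD_wdepthsFrom_le (w : GateFn → ℕ) {β : ι' → ℕ} {D : ℕ} (hβ : ∀ i, β i ≤ D)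
    (gs : List (Gate ι')) (m : ℕ) :
    (wdepthsFrom w β gs).getD m 0 ≤ D + (wdepths w gs).getD m 0 := by
  induction gs using List.reverseRecOn generalizing m with
  | nil => simp [wdepthsFrom]
  | append_singleton gs g ih =>
    rw [wdepthsFrom_append_singleton, wdepths_append_singleton]
    simp only [List.getD_eq_getElem?_getD]
    rcases Nat.lt_trichotomy m gs.length with hm | rfl | hm
    · rw [List.getElem?_append_left (by simpa using hm), List.getElem?_append_left (by simpa using hm)]
      simpa [List.getD_eq_getElem?_getD] using ih m
    · rw [List.getElem?_append_right (by simp), List.getElem?_append_right (by simp)]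
      simp only [length_wdepthsFrom, length_wdepths, Nat.sub_self, List.getElem?_cons_zero,
        Option.getD_some]
      have key : (univ.sup fun a => wireDepthFrom β (wdepthsFrom w β gs) (g.args a)) ≤
          D + univ.sup fun a => wireDepthOf (wdepths w gs) (g.args a) := by
        refine Finset.sup_le fun a _ => ?_
        have hle : wireDepthFrom β (wdepthsFrom w β gs) (g.args a) ≤
            D + wireDepthOf (wdepths w gs) (g.args a) := by
          cases h : g.args a with
          | inl i => simpa [wireDepthFrom] using hβ i
          | inr m' => simpa [wireDepthFrom, List.getD_eq_getElem?_getD] using ih m'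
        exact hle.trans (Nat.add_le_add_left (Finset.le_sup
          (f := fun a => wireDepthOf (wdepths w gs) (g.args a)) (Finset.mem_univ a)) D)
      omega
    · rw [List.getElem?_eq_none (by simp; omega), List.getElem?_eq_none (by simp; omega)]
      simp

/-- The wire version of the previous bound. [cite: Vollmer1999, §1.2] -/
theorem wireDepthFrom_le (w : GateFn → ℕ) {β : ι' → ℕ} {D : ℕ} (hβ : ∀ i, β i ≤ D)
    (gs : List (Gate ι')) (u : ι' ⊕ ℕ) :
    wireDepthFrom β (wdepthsFrom w β gs) u ≤ D + wireDepthOf (wdepths w gs) u := by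
  cases u with
  | inl i => simpa [wireDepthFrom] using hβ i
  | inr m => exact getD_wdepthsFrom_le w hβ gs m

end GateList

/-! ### Realizability with depth and size over `B₂` -/

/-- `NCVec F d s`: some well-formed gate list over `B2` with at most `s` gates has output wires,
one for each `k : κ`, all of (unit-weight) depth at most `d`, carrying `F x k` on every input `x`
(Vollmer 1999, §1.2: circuits of depth `d` and size `s` over the bounded fan-in basis, several
outputs). [cite: Vollmer1999, §1.2] -/
def NCVec (F : (ι → Bool) → κ → Bool) (d s : ℕ) : Prop :=
  ∃ (gs : List (Gate ι)) (out : κ → ι ⊕ ℕ), WF gs ∧ (∀ g ∈ gs, g.fn ∈ B2) ∧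
    (∀ k, OutOK gs.length (out k)) ∧ gs.length ≤ s ∧
    (∀ k, wireDepthOf (wdepths (fun _ => 1) gs) (out k) ≤ d) ∧
    ∀ x k, wireOf x (vals gs x) (out k) = F x k

namespace NCVec

variable {F G : (ι → Bool) → κ → Bool} {d d' s s' : ℕ}

/-- Monotonicity in depth and size. [folklore] -/
theorem mono (h : NCVec F d s) (hd : d ≤ d') (hs : s ≤ s') : NCVec F d' s' := by
  obtain ⟨gs, out, hwf, hB, ho, hl, hdep, hev⟩ := h
  exact ⟨gs, out, hwf, hB, ho, hl.trans hs, fun k => (hdep k).trans hd, hev⟩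

/-- Extensionality in the computed map. [folklore] -/
theorem congr (h : NCVec F d s) (hfg : ∀ x k, F x k = G x k) : NCVec G d s := by
  obtain ⟨gs, out, hwf, hB, ho, hl, hdep, hev⟩ := h
  exact ⟨gs, out, hwf, hB, ho, hl, hdep, fun x k => (hev x k).trans (hfg x k)⟩

/-- Renaming (selecting, duplicating) output wires is free. [folklore] -/
theorem outMap (h : NCVec F d s) (r : κ' → κ) : NCVec (fun x k' => F x (r k')) d s := by
  obtain ⟨gs, out, hwf, hB, ho, hl, hdep, hev⟩ := h
  exact ⟨gs, fun k' => out (r k'), hwf, hB, fun k' => ho (r k'), hl, fun k' => hdep (r k'),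
    fun x k' => hev x (r k')⟩

/-- **Extraction of a single-output circuit** over `B2` with `acDepth ≤ d` (indeed depth `≤ d`)
and size `≤ s` (Arora–Barak 2009, Rem. 6.4; `acDepth ≤ depth`). [cite: AroraBarakCC2009, Rem. 6.4] -/
theorem toCircuit {f : (ι → Bool) → Unit → Bool} (h : NCVec f d s) :
    ∃ C : Circuit ι, C.IsOver B2 ∧ C.acDepth ≤ d ∧ C.size ≤ s ∧ ∀ x, C.eval x = f x () := by
  obtain ⟨gs, out, hwf, hB, ho, hl, hdep, hev⟩ := h
  have hou := ho ()
  have hdepu := hdep ()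
  have hevu : ∀ x, wireOf x (vals gs x) (out ()) = f x () := fun x => hev x ()
  revert hou hdepu hevu
  generalize out () = o
  intro hou hdepu hevu
  let C : Circuit ι := ⟨gs, o, fun j hj a m ha => hwf j _ (List.getElem?_eq_getElem hj) a m ha, hou⟩
  refine ⟨C, hB, ?_, hl, fun x => ?_⟩
  · refine (acDepth_le_depth C).trans ?_
    change Circuit.depthWith C (fun _ => 1) ≤ d
    rw [circuit_depthWith]
    exact hdepu
  · cases o with
    | inl i => exact hevu x
    | inr m => exact hevu x

end NCVec

/-! ### Projections and single gates -/

/-- Projections (re-orderings, duplications) of inputs: depth `0`, no gate (Vollmer 1999, §1.1). [cite: Vollmer1999, §1.1] -/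
theorem ncVec_proj (π : κ → ι) : NCVec (fun (x : ι → Bool) k => x (π k)) 0 0 :=
  ⟨[], fun k => .inl (π k), WF.nil, fun g hg => by simp at hg, fun _ _ h => by simp at h, le_rfl,
    fun _ => le_rfl, fun _ _ => rfl⟩

/-- One gate of the basis on input wires: depth `1`, size `1` (Vollmer 1999, Def. 1.6). [cite: Vollmer1999, Def. 1.6] -/
theorem ncVec_gate (g : GateFn) (hg : g ∈ B2) (w : Fin g.1 → ι) :
    NCVec (fun (x : ι → Bool) (_ : Unit) => g.2 fun a => x (w a)) 1 1 := by
  refine ⟨[⟨g.1, g.2, fun a => .inl (w a)⟩], fun _ => .inr 0, ?_, ?_, ?_, le_rfl, fun _ => ?_,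
    fun x _ => ?_⟩
  · exact WF.singleton fun a m h => by simp at h
  · intro g' hg'
    rw [List.mem_singleton] at hg'
    subst hg'
    exact hg
  · intro _ m hm
    simp only [Sum.inr.injEq] at hm
    subst hm
    simp
  · simp only [wireDepthOf_inr]
    rw [getD_wdepths_singleton]
    simp
  · simp [vals]

/-! ### Sequential composition and juxtaposition -/

namespace NCVec

variable {F : (ι → Bool) → κ → Bool} {d d' s s' : ℕ}

/-- **Sequential composition**: if `F` is realized at depth `d` with `s` gates and
`G : (κ → Bool) → (μ → Bool)` at depth `d'` with `s'` gates, then `G ∘ F` is realized at depth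
`d + d'` with `s + s'` gates (Vollmer 1999, §1.2; depths add along the relocation,
`GateList.wdepths_append_reloc`). [cite: Vollmer1999, §1.2] -/
theorem comp {G : (κ → Bool) → μ → Bool} (hF : NCVec F d s) (hG : NCVec G d' s') :
    NCVec (fun x => G (F x)) (d + d') (s + s') := by
  obtain ⟨gs, out, hwf, hB, ho, hl, hdep, hev⟩ := hF
  obtain ⟨gs', out', hwf', hB', ho', hl', hdep', hev'⟩ := hG
  have hρ : WiresOK gs.length out := fun k m hk => ho k m hk
  refine ⟨gs ++ gs'.map (reloc out gs.length), fun m => shiftWire out gs.length (out' m),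
    hwf.append_reloc hwf' hρ, ?_, ?_, by simp; omega, fun m => ?_, fun x m => ?_⟩
  · intro g hg
    rcases List.mem_append.1 hg with h | h
    · exact hB g h
    · obtain ⟨g', hg', rfl⟩ := List.mem_map.1 h
      simpa using hB' g' hg'
  · intro m
    have := wiresOK_shiftWire hρ (fun m n h => ho' m n h) m
    simpa using this
  · rw [wdepths_append_reloc _ gs gs' out hρ,
      wireDepthOf_shiftWire _ _ (length_wdepths _ gs) out hρ]
    exact (wireDepthFrom_le _ (fun k => hdep k) gs' (out' m)).trans (Nat.add_le_add_left (hdep' m) d)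
  · rw [vals_append_reloc gs gs' out hρ x, wireOf_shiftWire x _ _ (length_vals gs x) out hρ]
    have hy : (fun i => wireOf x (vals gs x) (out i)) = F x := funext (hev x)
    rw [hy, hev']

/-- **Juxtaposition**: bundling the outputs of two blocks on the same inputs; depth `max`, sizes
add (Vollmer 1999, §1.2). [cite: Vollmer1999, §1.2] -/
theorem pair {G : (ι → Bool) → κ' → Bool} (hF : NCVec F d s) (hG : NCVec G d' s') :
    NCVec (fun x => Sum.elim (F x) (G x)) (max d d') (s + s') := by
  obtain ⟨gs, out, hwf, hB, ho, hl, hdep, hev⟩ := hF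
  obtain ⟨gs', out', hwf', hB', ho', hl', hdep', hev'⟩ := hG
  have hρ : WiresOK gs.length (fun i => (Sum.inl i : ι ⊕ ℕ)) := wiresOK_inl _ _root_.id
  refine ⟨gs ++ gs'.map (reloc (fun i => Sum.inl i) gs.length),
    Sum.elim out (fun k' => shiftWire (fun i => Sum.inl i) gs.length (out' k')),
    hwf.append_reloc hwf' hρ, ?_, ?_, by simp; omega, ?_, ?_⟩
  · intro g hg
    rcases List.mem_append.1 hg with h | h
    · exact hB g h
    · obtain ⟨g', hg', rfl⟩ := List.mem_map.1 h
      simpa using hB' g' hg'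
  · rintro (k | k') m hk
    · simp only [Sum.elim_inl] at hk
      have := ho k m hk
      simp; omega
    · simp only [Sum.elim_inr] at hk
      simpa using wiresOK_shiftWire hρ (fun m n h => ho' m n h) k' m hk
  · rintro (k | k')
    · simp only [Sum.elim_inl]
      rw [wireDepthOf_wdepths_append _ gs _ (out k) (ho k)]
      exact (hdep k).trans (le_max_left _ _)
    · simp only [Sum.elim_inr]
      rw [wdepths_append_reloc _ gs gs' _ hρ, wireDepthOf_shiftWire _ _ (length_wdepths _ gs) _ hρ]
      refine (wireDepthFrom_le _ (D := 0) (fun i => le_rfl) gs' (out' k')).trans ?_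
      rw [zero_add]
      exact (hdep' k').trans (le_max_right _ _)
  · rintro x (k | k')
    · simp only [Sum.elim_inl]
      rw [vals_append_reloc gs gs' _ hρ x, wireOf_append_of_lt _ _ _ _ (fun m hm =>
        (length_vals gs x).symm ▸ ho k m hm), hev]
    · simp only [Sum.elim_inr]
      rw [vals_append_reloc gs gs' _ hρ x, wireOf_shiftWire x _ _ (length_vals gs x) _ hρ]
      simp only [wireOf_inl]
      exact hev' x k'

/-- Post-composing one gate of fan-in `≤ 2` on two outputs: depth `+ 1`, size `+ 1`. [cite: Vollmer1999, §1.2] -/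
theorem gate₂ (h : NCVec F d s) (op : Bool → Bool → Bool) (k₁ k₂ : κ) :
    NCVec (fun x (_ : Unit) => op (F x k₁) (F x k₂)) (d + 1) (s + 1) :=
  (h.comp (ncVec_gate ⟨2, fun v => op (v 0) (v 1)⟩ (by simp [B2]) ![k₁, k₂])).congr
    fun _ _ => rfl

/-- Post-composing one unary gate on an output: depth `+ 1`, size `+ 1`. [cite: Vollmer1999, §1.2] -/
theorem gate₁ (h : NCVec F d s) (op : Bool → Bool) (k₁ : κ) :
    NCVec (fun x (_ : Unit) => op (F x k₁)) (d + 1) (s + 1) :=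
  (h.comp (ncVec_gate ⟨1, fun v => op (v 0)⟩ (by simp [B2]) fun _ => k₁)).congr fun _ _ => rfl

/-- Bundling `M` single-output blocks of equal depth and size bounds (Vollmer 1999, §1.2). [cite: Vollmer1999, §1.2] -/
theorem pi_fin {M : ℕ} {f : (ι → Bool) → Fin M → Bool} (h : ∀ j, NCVec (fun x (_ : Unit) => f x j) d s) :
    NCVec f d (M * s) := by
  induction M with
  | zero =>
    exact ⟨[], fun j => j.elim0, WF.nil, fun g hg => by simp at hg, fun j => j.elim0, by simp,
      fun j => j.elim0, fun _ j => j.elim0⟩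
  | succ M ih =>
    have h1 : NCVec (fun x (j : Fin M) => f x j.castSucc) d (M * s) := ih fun j => h j.castSucc
    have h2 := h1.pair (h (Fin.last M))
    refine ((h2.outMap fun j : Fin (M + 1) =>
      if hj : (j : ℕ) < M then Sum.inl ⟨j, hj⟩ else Sum.inr ()).congr fun x j => ?_).mono
      (max_le le_rfl le_rfl) (by rw [Nat.succ_mul])
    by_cases hj : (j : ℕ) < M
    · simp only [hj, ↓reduceDIte, Sum.elim_inl]
      rfl
    · simp only [hj, ↓reduceDIte, Sum.elim_inr]
      congr 1
      exact (Fin.eq_last_of_not_lt hj).symm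

end NCVec

/-! ### Balanced binary trees -/

/-- The balanced binary fold of `M` values: `z` for `M = 0`, the value itself for `M = 1`, and
otherwise `op` of the folds of the first `⌊M/2⌋` and the last `⌈M/2⌉` values (the shape of a
logarithmic-depth tree of binary gates; Vollmer 1999, §1.3). [cite: Vollmer1999, §1.3] -/
def treeFold {V : Type*} (op : V → V → V) (z : V) : (M : ℕ) → (Fin M → V) → V
  | 0, _ => z
  | 1, v => v 0
  | (M + 2), v =>
    op (treeFold op z ((M + 2) / 2) fun j => v (Fin.castLE (Nat.div_le_self _ _) j))
      (treeFold op z ((M + 2) - (M + 2) / 2) fun j =>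
        v ⟨(M + 2) / 2 + (j : ℕ), by have := j.2; omega⟩)
  termination_by M => M

/-- **The balanced fold of an addition is the sum** (in any additive commutative monoid). [folklore] -/
theorem treeFold_add {V : Type*} [AddCommMonoid V] : ∀ (M : ℕ) (v : Fin M → V),
    treeFold (· + ·) 0 M v = ∑ j, v j
  | 0, v => by simp [treeFold]
  | 1, v => by simp [treeFold]
  | (M + 2), v => by
    rw [treeFold, treeFold_add, treeFold_add]
    have h : (M + 2) / 2 + ((M + 2) - (M + 2) / 2) = M + 2 := by omega
    rw [← Equiv.sum_comp (finCongr h) v, Fin.sum_univ_add]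
    congr 1

/-- **Folds commute with homomorphisms**: if `φ (opV a b) = opW (φ a) (φ b)` and `φ zV = zW`
then `φ (treeFold opV zV M v) = treeFold opW zW M (φ ∘ v)` (used to read an encoded sum as the
sum of the decoded values). [folklore] -/
theorem treeFold_map {V W : Type*} (opV : V → V → V) (zV : V) (opW : W → W → W) (zW : W)
    (φ : V → W) (hop : ∀ a b, φ (opV a b) = opW (φ a) (φ b)) (hz : φ zV = zW) :
    ∀ (M : ℕ) (v : Fin M → V), φ (treeFold opV zV M v) = treeFold opW zW M (fun j => φ (v j))
  | 0, v => by simp [treeFold, hz]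
  | 1, v => by simp [treeFold]
  | (M + 2), v => by
    rw [treeFold, treeFold, hop, treeFold_map opV zV opW zW φ hop hz,
      treeFold_map opV zV opW zW φ hop hz]

/-- `⌈log₂ ⌈n/2⌉⌉ + 1 = ⌈log₂ n⌉` for `n ≥ 2`, in the form used for the two halves. [folklore] -/
theorem clog_two_halves (M : ℕ) :
    Nat.clog 2 ((M + 2) / 2) + 1 ≤ Nat.clog 2 (M + 2) ∧
      Nat.clog 2 ((M + 2) - (M + 2) / 2) + 1 ≤ Nat.clog 2 (M + 2) := by
  have h := Nat.clog_of_two_le (b := 2) one_lt_two (show 2 ≤ M + 2 by omega)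
  have hc : (M + 2 + 2 - 1) / 2 = (M + 3) / 2 := by omega
  rw [hc] at h
  constructor
  · rw [h]
    exact Nat.add_le_add_right (Nat.clog_mono_right 2 (by omega)) 1
  · rw [h]
    exact Nat.add_le_add_right (Nat.clog_mono_right 2 (by omega)) 1

namespace NCVec

/-- **The tree gadget**: given a two-argument gadget `op` on `b`-bit values realized at depth
`dop` with `sop` gates, the balanced fold of `M ≥ 1` values (read off the inputs
`Fin M × Fin b`) is realized at depth `⌈log₂ M⌉ · dop` with `(M − 1) · sop` gates
(Vollmer 1999, §1.3, logarithmic-depth trees of binary gates). [cite: Vollmer1999, §1.3] -/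
theorem treeGadget {b : ℕ} {op : (Fin b → Bool) → (Fin b → Bool) → Fin b → Bool} {dop sop : ℕ}
    (hop : NCVec (fun (y : Fin b ⊕ Fin b → Bool) => op (fun i => y (.inl i)) fun i => y (.inr i))
      dop sop)
    (z : Fin b → Bool) : ∀ (M : ℕ), 1 ≤ M →
      NCVec (fun (y : Fin M × Fin b → Bool) => treeFold op z M fun j i => y (j, i))
        (Nat.clog 2 M * dop) ((M - 1) * sop)
  | 0, h => absurd h (by omega)
  | 1, _ => ((ncVec_proj fun i : Fin b => ((0 : Fin 1), i)).congr fun y i => by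
      simp [treeFold]).mono (by simp) (by simp)
  | (M + 2), _ => by
    have ha : 1 ≤ (M + 2) / 2 := by omega
    have hb : 1 ≤ (M + 2) - (M + 2) / 2 := by omega
    have hL := treeGadget hop z ((M + 2) / 2) ha
    have hR := treeGadget hop z ((M + 2) - (M + 2) / 2) hb
    -- read the two halves off the inputs `Fin (M + 2) × Fin b`
    have hL' := (ncVec_proj (ι := Fin (M + 2) × Fin b) fun p : Fin ((M + 2) / 2) × Fin b =>
      (Fin.castLE (Nat.div_le_self _ _) p.1, p.2)).comp hL
    have hR' := (ncVec_proj (ι := Fin (M + 2) × Fin b) fun p : Fin ((M + 2) - (M + 2) / 2) × Fin b =>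
      ((⟨(M + 2) / 2 + (p.1 : ℕ), by have := p.1.2; omega⟩ : Fin (M + 2)), p.2)).comp hR
    have h := (hL'.pair hR').comp hop
    obtain ⟨h1, h2⟩ := clog_two_halves M
    refine (h.congr fun y i => ?_).mono ?_ ?_
    · simp only [Sum.elim_inl, Sum.elim_inr]
      rw [treeFold]
    · simp only [zero_add]
      have := Nat.mul_le_mul_right dop h1
      have := Nat.mul_le_mul_right dop h2
      rw [Nat.add_mul, one_mul] at *
      omega
    · simp only [zero_add]
      have hsum : ((M + 2) / 2 - 1) * sop + ((M + 2) - (M + 2) / 2 - 1) * sop + sop =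
          (M + 2 - 1) * sop := by
        rw [← Nat.add_mul, ← Nat.succ_mul]
        congr 1
        omega
      omega

/-- **A balanced tree of gadgets on the outputs of a block**: depth `+ ⌈log₂ M⌉ · dop`, size
`+ (M − 1) · sop`. [cite: Vollmer1999, §1.3] -/
theorem tree {b : ℕ} {op : (Fin b → Bool) → (Fin b → Bool) → Fin b → Bool} {dop sop : ℕ}
    (hop : NCVec (fun (y : Fin b ⊕ Fin b → Bool) => op (fun i => y (.inl i)) fun i => y (.inr i))
      dop sop)
    (z : Fin b → Bool) {M : ℕ} (hM : 1 ≤ M) {F : (ι → Bool) → Fin M × Fin b → Bool} {d s : ℕ}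
    (hF : NCVec F d s) :
    NCVec (fun x => treeFold op z M fun j i => F x (j, i)) (d + Nat.clog 2 M * dop)
      (s + (M - 1) * sop) :=
  hF.comp (treeGadget hop z M hM)

end NCVec

/-! ### Every Boolean function, at depth linear in the number of variables -/

/-- The two-level multiplexer gadget on the four wires `c, ¬c, a, b`: `(c ∧ a) ∨ (¬c ∧ b)`,
depth `2`, size `3`. [folklore] -/
theorem ncVec_mux4 :
    NCVec (fun (y : (Unit ⊕ Unit) ⊕ (Unit ⊕ Unit) → Bool) (_ : Unit) =>
      (y (.inl (.inl ())) && y (.inr (.inl ())) || y (.inl (.inr ())) && y (.inr (.inr ()))))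
      2 3 := by
  have h1 : NCVec (fun (y : (Unit ⊕ Unit) ⊕ (Unit ⊕ Unit) → Bool) =>
      Sum.elim (fun (_ : Unit) => (y (.inl (.inl ())) && y (.inr (.inl ()))))
        (fun (_ : Unit) => (y (.inl (.inr ())) && y (.inr (.inr ()))))) (max 1 1) (1 + 1) :=
    (((ncVec_proj (_root_.id : (Unit ⊕ Unit) ⊕ (Unit ⊕ Unit) → _)).gate₂ (· && ·)
        (Sum.inl (Sum.inl ())) (Sum.inr (Sum.inl ()))).mono (by simp) (by simp)).pair
      (((ncVec_proj (_root_.id : (Unit ⊕ Unit) ⊕ (Unit ⊕ Unit) → _)).gate₂ (· && ·)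
        (Sum.inl (Sum.inr ())) (Sum.inr (Sum.inr ()))).mono (by simp) (by simp))
  exact (h1.gate₂ (· || ·) (.inl ()) (.inr ())).congr fun y _ => by simp

/-- **Every Boolean function of `m` variables** is realized over `B₂` at depth `2m + 1` with
`univBound m = 5 · 2^m − 4` gates (Shannon expansion `f = (x₀ ∧ f|₁) ∨ (¬x₀ ∧ f|₀)`, the two
cofactors side by side; Arora–Barak 2009, Claim 2.13; Vollmer 1999, §1.3). [cite: AroraBarakCC2009, Claim 2.13] -/
theorem ncVec_univ_fin : ∀ (m : ℕ) (f : (Fin m → Bool) → Unit → Bool),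
    NCVec f (2 * m + 1) (univBound m)
  | 0, f => by
    refine ((ncVec_gate ⟨0, fun _ => f Fin.elim0 ()⟩ (by simp [B2]) Fin.elim0).congr
      fun x u => ?_).mono (by simp) (by simp [univBound])
    rw [Subsingleton.elim x Fin.elim0]
  | m + 1, f => by
    -- the two cofactors, as functions of all `m + 1` variables
    have hc : ∀ b : Bool, NCVec (fun (x : Fin (m + 1) → Bool) (u : Unit) =>
        f (Fin.cons b fun i => x i.succ) u) (2 * m + 1) (univBound m) := fun b =>
      (((ncVec_proj (ι := Fin (m + 1)) Fin.succ).comp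
        (ncVec_univ_fin m fun x' => f (Fin.cons b x'))).mono (by simp) (by simp))
    -- `x₀` and `¬x₀`
    have h0 : NCVec (fun (x : Fin (m + 1) → Bool) =>
        Sum.elim (fun (_ : Unit) => x 0) (fun (_ : Unit) => !x 0)) (max 0 (0 + 1)) (0 + (0 + 1)) :=
      (ncVec_proj fun _ : Unit => (0 : Fin (m + 1))).pair
        ((ncVec_proj fun _ : Unit => (0 : Fin (m + 1))).gate₁ (! ·) ())
    have h1 := h0.pair ((hc true).pair (hc false))
    have h2 := h1.comp ncVec_mux4
    refine (h2.congr fun x u => ?_).mono ?_ ?_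
    · obtain ⟨⟩ := u
      simp only [Sum.elim_inl, Sum.elim_inr]
      conv_rhs => rw [← Fin.cons_self_tail x]
      cases x 0 <;> simp <;> rfl
    · simp; omega
    · simp [univBound]; omega

/-- Every Boolean function on a finite set `ι'` of variables is realized over `B₂` at depth
`2 · card ι' + 1` with `univBound (card ι')` gates. [cite: AroraBarakCC2009, Claim 2.13] -/
theorem ncVec_univ {ι' : Type*} [Fintype ι'] (f : (ι' → Bool) → Unit → Bool) :
    NCVec f (2 * Fintype.card ι' + 1) (univBound (Fintype.card ι')) := by
  classical
  set e := Fintype.equivFin ι'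
  exact (((ncVec_proj (ι := ι') fun i => e.symm i).comp
    (ncVec_univ_fin (Fintype.card ι') fun x' => f fun i => x' (e i))).congr fun x _ => by simp).mono
    (by simp) (by simp)

/-- **Every multi-output map on finitely many variables** (`b` outputs): depth
`2 · card ι' + 1`, size `b · univBound (card ι')` — the form in which constant-size arithmetic
gadgets over a fixed finite field are obtained. [cite: AroraBarakCC2009, Claim 2.13] -/
theorem ncVec_univVec {ι' : Type*} [Fintype ι'] {b : ℕ} (F : (ι' → Bool) → Fin b → Bool) :
    NCVec F (2 * Fintype.card ι' + 1) (b * univBound (Fintype.card ι')) :=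
  NCVec.pi_fin fun j => ncVec_univ fun x _ => F x j

end Literature.Computability.Complexity
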